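import Summits.Ventures.HSemireg.WedgeHankelRecurrenceMarkovMoments
import Summits.Ventures.HSemireg.WedgeHankelRecurrenceGaussFavardConsistent

/-!
# Venture HSemireg — **THE HANKEL FORMS OF A POSITIVE RECURRENCE ARE POSITIVE DEFINITE** (back to Gantmacher's Hankel world): the moments `s_p = Σ_k μ_k z_k^p` of the level-`m` Favard
# measure (N281) do not depend on the level for `p ≤ 2m + 1` (N286), the quadratic functional is positive on non-zero polynomials of degree `≤ m`, and the Hankel matrix `(s_{i+j})_{i,j ≤ m}` is
# positive definite with positive determinant — Favard's functional is POSITIVE DEFINITE in Hamburger's sense (Gantmacher XV §16 (122), this lineage's `hankelSq`)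

HONEST FRAMING. Part of the Lean index of the computation cell `pub-hsemireg` (seat p10 gen 42, Sunday typer «UNIFORM-IN-n»).  Real polynomials, finite sums and the lineage's Hankel matrices
(`hankelSq`, `secSeq`, N235 `posDef_hankelSq_secSeq`); no variety, no cohomology theory, no sheaf, no Ext group and no semiregularity map is constructed here; nothing here says that HC / HC_CM /
HC_AV holds; no Literature fact (unproved `Prop`) is declared or used.  Custodian versions as in `WedgeHankelSiegelIdeal` (1/3).
SOURCES (cited).  F. R. Gantmacher, *The Theory of Matrices* II, Ch. XV §16 (121)–(122) (`H_t = Vᵀ diag(μ) V ≻ 0`); T. S. Chihara, *An Introduction to Orthogonal Polynomials* (1978), Ch. I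
Thm 3.4 + Thm 4.4 (positive-definite moment functionals ⟺ positive recurrences, Hankel determinants `Δ_n > 0`); H. Hamburger, *Über eine Erweiterung des Stieltjesschen Momentenproblems*,
Math. Ann. 81 (1920); J. Favard 1935.
PROOF TYPED HERE.  `s = secSeq μ z` with `μ > 0` and distinct `z` (N281), so N235's `posDef_hankelSq_secSeq` applies; level-independence is N286 at `F = X^p`.
DEDUP DISCLOSURE (`rg -n 'favard.*hankel|hankelSq.*recurrence' Summits/Ventures/HSemireg`, 2026-09-02): N235 ∕ N170 give the Hankel positivity of an atomic measure; the link to a positive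
three-term recurrence is new.  The 4 names below: 0 hits tree-wide.

WHAT IS IN THE TREE.  N235 `posDef_hankelSq_secSeq` (`WedgeHankelRecurrenceMarkovMoments`), `hankelSq`, `secSeq`; N273 `sum_mul_eval_sq_pos_of_natDegree_lt`; N281 `favard_finite_explicit`; N286
`favard_consistent`; Mathlib `Matrix.PosDef.det_pos`.
THIS FILE (namespace `Summit.Ventures.HSemireg.Wedge.HankelOuter` continued; CHAINED on N286 (import) and N235; 0 definitions):
* §1052 `favard_moments_agree` (`Σ μ^{(m)} z^p = Σ μ^{(n)} y^p`, `p ≤ 2m + 1`), `favard_sum_sq_pos` (`Σ_k μ_k P(z_k)² > 0` for `P ≠ 0`, `deg P ≤ m`), **`favard_hankelSq_posDef`** (the Hankel matrix of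
  the Favard moments is positive definite), `favard_hankelSq_det_pos` (`det > 0`).
CAVEATS.  Nothing Ext-side.  New names only.
-/

open Module Polynomial
open scoped Matrix Polynomial

namespace Summit.Ventures.HSemireg.Wedge.HankelOuter

open Summit.Ventures.HSemireg.Wedge.HankelSecant (secSeq)

/-! ## §1052. Favard's functional is positive definite -/

/-- **The Favard moments do not depend on the level**: for `m < n` and the explicit Favard measures of N281, `Σ_k μ^{(m)}_k z_k^p = Σ_l μ^{(n)}_l y_l^p` for all `p ≤ 2m + 1`.
[Chihara I Thm 4.4; this file, §1052] -/
theorem favard_moments_agree {q : ℕ → ℝ[X]} {a b : ℕ → ℝ} (hq0 : q 0 = 1) (hq1 : q 1 = Polynomial.X - C (a 0))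
    (hrec : ∀ n, q (n + 2) = (Polynomial.X - C (a (n + 1))) * q (n + 1) - C (b (n + 1)) * q n) (hb : ∀ j, 0 < b j) {m n : ℕ} (hmn : m < n) :
    ∃ (z : Fin (m + 1) → ℝ) (y : Fin (n + 1) → ℝ), StrictMono z ∧ StrictMono y ∧ (∀ k, (q (m + 1)).eval (z k) = 0) ∧ (∀ l, (q (n + 1)).eval (y l) = 0) ∧
      ∀ p, p ≤ 2 * m + 1 →
        ∑ k, (∏ l ∈ Finset.Ico 1 (m + 1), b l) / ((derivative (q (m + 1))).eval (z k) * (q m).eval (z k)) * z k ^ p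
          = ∑ l, (∏ l' ∈ Finset.Ico 1 (n + 1), b l') / ((derivative (q (n + 1))).eval (y l) * (q n).eval (y l)) * y l ^ p := by
  obtain ⟨z, y, hz, hy, hzr, hyr, hagree⟩ := favard_consistent hq0 hq1 hrec hb hmn
  refine ⟨z, y, hz, hy, hzr, hyr, fun p hp => ?_⟩
  have h := hagree (Polynomial.X ^ p) (by rw [natDegree_X_pow]; exact hp)
  simpa only [eval_pow, eval_X] using h

/-- **Positivity of the quadratic functional**: with positive weights on `m + 1` distinct nodes, `Σ_k μ_k P(z_k)² > 0` for every non-zero `P` of degree `≤ m` (it cannot vanish at all nodes).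
[Chihara I Thm 3.4; this file, §1052] -/
theorem favard_sum_sq_pos {m : ℕ} {μ z : Fin (m + 1) → ℝ} (hμ : ∀ k, 0 < μ k) (hz : Function.Injective z) {P : ℝ[X]} (hP : P ≠ 0) (hPd : P.natDegree ≤ m) :
    0 < ∑ k, μ k * (P.eval (z k)) ^ 2 :=
  sum_mul_eval_sq_pos_of_natDegree_lt hμ hz hP (by omega)

/-- **THE HANKEL MATRIX OF THE FAVARD MOMENTS IS POSITIVE DEFINITE**: for a positive recurrence and any `m`, with the level-`m` Favard measure `(μ, z)` of N281, the Hankel matrix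
`(Σ_k μ_k z_k^{i+j})_{i,j ≤ m} = hankelSq ℝ m (secSeq ℝ μ z)` is positive definite. [Gantmacher XV §16 (122); Chihara I Thm 3.4 + 4.4; Hamburger 1920; this file, §1052] -/
theorem favard_hankelSq_posDef {q : ℕ → ℝ[X]} {a b : ℕ → ℝ} (hq0 : q 0 = 1) (hq1 : q 1 = Polynomial.X - C (a 0))
    (hrec : ∀ n, q (n + 2) = (Polynomial.X - C (a (n + 1))) * q (n + 1) - C (b (n + 1)) * q n) (hb : ∀ j, 0 < b j) (m : ℕ) :
    ∃ z : Fin (m + 1) → ℝ, StrictMono z ∧ (∀ k, (q (m + 1)).eval (z k) = 0) ∧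
      (hankelSq ℝ m (secSeq ℝ (fun k => (∏ l ∈ Finset.Ico 1 (m + 1), b l) / ((derivative (q (m + 1))).eval (z k) * (q m).eval (z k))) z)).PosDef := by
  obtain ⟨z, hz, hzr, hμpos, -, -⟩ := favard_finite_explicit hq0 hq1 hrec hb m
  exact ⟨z, hz, hzr, posDef_hankelSq_secSeq hμpos hz.injective⟩

/-- **… hence its determinant (Hamburger's `Δ_m`) is positive.** [Chihara I Thm 3.4; this file, §1052] -/
theorem favard_hankelSq_det_pos {q : ℕ → ℝ[X]} {a b : ℕ → ℝ} (hq0 : q 0 = 1) (hq1 : q 1 = Polynomial.X - C (a 0))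
    (hrec : ∀ n, q (n + 2) = (Polynomial.X - C (a (n + 1))) * q (n + 1) - C (b (n + 1)) * q n) (hb : ∀ j, 0 < b j) (m : ℕ) :
    ∃ z : Fin (m + 1) → ℝ, StrictMono z ∧ (∀ k, (q (m + 1)).eval (z k) = 0) ∧
      0 < (hankelSq ℝ m (secSeq ℝ (fun k => (∏ l ∈ Finset.Ico 1 (m + 1), b l) / ((derivative (q (m + 1))).eval (z k) * (q m).eval (z k))) z)).det := by
  obtain ⟨z, hz, hzr, hpd⟩ := favard_hankelSq_posDef hq0 hq1 hrec hb m
  exact ⟨z, hz, hzr, hpd.det_pos⟩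

end Summit.Ventures.HSemireg.Wedge.HankelOuter
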